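import Mathlib
import Summits.AnomalousDissipation.AnomalousDissipation.Theses.MarginalStabilityChain
import Literature.Topology.Euclidean.BrouwerNormedSpace

/-!
# Vocabulary and glue of the line `Sketch` (vortex-sheet unfolding + dissipative persistence)
# for the crux `MarginalStabilityChain.BurgersLayerKH` (stmt-AnomalousDissipation-3008)

Definitions-only support file plus SORRY-FREE glue, so that the line's REGISTERED STUBS — landed one
by one as `--supports stmt-AnomalousDissipation-3008` files under `Theorems/` — and the lead's skeleton
(`Cruxes/BurgersLayerKH/Lines/Sketch.lean`, not importable) speak about the SAME declarations, and the
CONDITIONAL composition `BurgersLayerKH_of` / registered sub-goal `line_glue` whose seven hypotheses are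
exactly the seven registered stubs (`ledger skeleton check`, 2026-08-16) and whose conclusion is the
crux BY NAME.  No facts are asserted: the `…Package` predicates below are the stub STATEMENTS (targets of
this line), not cited results.

Architecture (lead prover, 2026-08-16).  Divide the crux equation by `α·Re` and write `h := 1/(α Re)`,
`λ := σ h`:

  `(λ + iU) ω − h (ω'' + y ω' + (1 − α²) ω) = −i U'' ψ`,   `ω = −(ψ'' − α² ψ)`.          (E_h)

At `h = 0` this is Rayleigh's equation `ψ'' = (α² + U''/(U − iλ)) ψ` (`c = iλ`).  A SLOW MODE
(`IsSlowMode α h λ ψ`) is a `C⁴` solution of (E_h) on `ℝ` with Gaussian-class vorticity, normalised by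
`e^{αy} ψ(y) → 1` at `+∞` and of linear growth `|e^{αy}ψ| ≤ C(1+|y|)`.  Its SHEET COEFFICIENT
`a = sheetCoeff α ψ = 1 − (2α)⁻¹ ∫ e^{αt} ω` is the coefficient of the growing mode `e^{−αy}` at `−∞`
(`e^{αy}ψ(y) → a`), so `a = 0` iff `ψ` is an eigenfunction (`ModeOfZero`).  Two limits:

* `h → 0` (dissipative persistence, `StrainedPackage`): slow modes exist for small `h`, their sheet
  coefficient is continuous in `λ` and within `ε` of the Rayleigh one — built from the Gaussian-class
  RESOLVENT of `λ + iU − h·OU` (`ResolventExistence/Uniqueness`: Green's function of two recessive Weber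
  solutions, bound `‖ω‖ ≤ K‖F‖/re λ` UNIFORM in `h`; uniqueness = Weber energy lemma) and the weighted
  Volterra theory (`VolterraPackage`);
* `α → 0` (vortex-sheet unfolding, `SheetLimitPackage`): the Rayleigh sheet coefficient tends to the
  explicit Helmholtz dispersion function `sheetEvans λ = (λ² − U₊²)/(λ² + U₊²)`, `U₊ = √(π/2)`,
  uniformly on the disc `|λ − U₊| ≤ U₊/4` (first-order Jost expansion; `∫ U''/(U₊−iλ) = 0`,
  `∫ V m₁ = −4U₊²/(U₊²+λ²)`).

Composition (`BurgersLayerKH_of`, sorry-free below): `sheetEvans` has the simple zero `U₊`; by the two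
limits the strained sheet coefficient is within `1/8` of it on the disc, so the Newton-type map
`λ ↦ λ − U₊·a_h(λ)` maps the disc into itself and has a fixed point by BROUWER
(`Literature.Topology.Euclidean.Brouwer.exists_fixedPoint_closedBall_of_finiteDimensional`): a zero
`λ*` with `re λ* ≥ 3U₊/4`, i.e. an eigenmode with `re σ = α·re λ*·Re ≥ (3αU₊/4)·Re`.

Registered stubs (skeleton): `stub_volterra`, `stub_rayleighJost`, `stub_sheetLimit`,
`stub_resolventExists`, `stub_resolventUnique`, `stub_strained`, `stub_modeOfZero` (signatures in the
docstrings of §2) and `line_glue` (§4); each stub lands in its own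
`Theorems/MarginalStabilityChainBurgersLayerKHStub….lean` in a sub-namespace of this file's namespace.

References: Drazin–Reid, *Hydrodynamic Stability* (2nd ed. 2004) §23 (long-wave limit of the Rayleigh
problem = vortex sheet); Beronov–Kida, Phys. Fluids 8 (1996) 1024 (numerics of exactly this operator);
the route file `Theses/MarginalStabilityChain.lean` (item 3008); `Cruxes/BurgersLayerKH/PICKED.md`.
-/

set_option linter.dupNamespace false

noncomputable section

open Complex MeasureTheory Filter Topology Set Metric

namespace Summit.AnomalousDissipation.AnomalousDissipation.Theorems.BurgersLayerKH.Sheet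

open Summit.AnomalousDissipation.AnomalousDissipation.Theses.MarginalStabilityChain

/-! ## §1 Vocabulary -/

/-- The Burgers-layer profile in similarity units, `U(y) = ∫₀ʸ e^{-s²/2} ds`. [folklore] -/
def U (y : ℝ) : ℝ := ∫ s in (0:ℝ)..y, Real.exp (-(s ^ 2) / 2)

/-- `U''(y) = -y e^{-y²/2}`. [folklore] -/
def Upp (y : ℝ) : ℝ := -(y * Real.exp (-(y ^ 2) / 2))

/-- The far-field value `U₊ = U(+∞) = √(π/2)` (half the velocity jump of the sheet). [folklore] -/
def Uinf : ℝ := Real.sqrt (Real.pi / 2)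

/-- Vorticity of a stream function at wavenumber `α`: `ω = -(ψ'' - α² ψ)` (literally the crux's `let ω`).
[folklore] -/
def vort (α : ℝ) (ψ : ℝ → ℂ) (y : ℝ) : ℂ := -(iteratedDeriv 2 ψ y - (α : ℂ) ^ 2 * ψ y)

/-- The strain + viscous (Ornstein–Uhlenbeck type) part `ω'' + y ω' + (1 - α²) ω`. [folklore] -/
def ou (α : ℝ) (ω : ℝ → ℂ) (y : ℝ) : ℂ :=
  iteratedDeriv 2 ω y + (y : ℂ) * deriv ω y + (1 - (α : ℂ) ^ 2) * ω y

/-- The Gaussian class of the crux: `‖F y‖ ≤ C e^{-y²/4}`. [folklore] -/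
def GaussBound (F : ℝ → ℂ) (C : ℝ) : Prop := ∀ y : ℝ, ‖F y‖ ≤ C * Real.exp (-(y ^ 2) / 4)

/-- Gaussian-class `C²` solution `ω` of the RESOLVENT EQUATION `(λ + iU) ω - h·(ω'' + yω' + (1-α²)ω) = F`
on `ℝ` (`h = 1/(α Re)`, `λ = σ h`). [folklore] -/
def IsResolventSol (α h : ℝ) (lam : ℂ) (F ω : ℝ → ℂ) : Prop :=
  ContDiff ℝ 2 ω ∧ (∃ C : ℝ, GaussBound ω C) ∧
    ∀ y : ℝ, (lam + I * U y) * ω y - (h : ℂ) * ou α ω y = F y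

/-- A SLOW (Jost-type) MODE of the scaled strained Rayleigh equation at `(α, h, λ)`: a `C⁴` function
`ψ` on `ℝ` with `(λ + iU) ω - h·(ω'' + yω' + (1-α²)ω) = -i U'' ψ`, `ω = vort α ψ` in the Gaussian class,
normalised by `e^{αy} ψ(y) → 1` at `+∞`, of at most linear growth `‖e^{αy} ψ(y)‖ ≤ C (1 + |y|)`.
At `h = 0` this is the Jost solution of Rayleigh's equation `ψ'' = (α² + U''/(U - iλ)) ψ`. [folklore] -/
def IsSlowMode (α h : ℝ) (lam : ℂ) (ψ : ℝ → ℂ) : Prop :=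
  ContDiff ℝ 4 ψ ∧
    (∀ y : ℝ, (lam + I * U y) * vort α ψ y - (h : ℂ) * ou α (vort α ψ) y = -(I * Upp y) * ψ y) ∧
    (∃ C : ℝ, GaussBound (vort α ψ) C) ∧
    Tendsto (fun y : ℝ => (Real.exp (α * y) : ℂ) * ψ y) atTop (𝓝 1) ∧
    ∃ C : ℝ, ∀ y : ℝ, ‖(Real.exp (α * y) : ℂ) * ψ y‖ ≤ C * (1 + |y|)

/-- The SHEET COEFFICIENT `a = 1 - (2α)⁻¹ ∫ e^{αt} ω(t) dt` of a slow mode: the coefficient of the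
growing mode `e^{-αy}` at `-∞` (`e^{αy} ψ(y) → a` as `y → -∞`); `a = 0` iff `ψ` decays at both ends.
[folklore] -/
def sheetCoeff (α : ℝ) (ψ : ℝ → ℂ) : ℂ :=
  1 - (1 / (2 * (α : ℂ))) * ∫ t : ℝ, (Real.exp (α * t) : ℂ) * vort α ψ t

/-- The Helmholtz vortex-sheet dispersion function in the variable `λ = -ic`:
`(λ² - U₊²)/(λ² + U₊²)`, the `α → 0` limit of the Rayleigh sheet coefficient; simple zero at `λ = U₊`
(the Kelvin–Helmholtz root `c = iU₊ = iΔU/2`). [folklore] -/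
def sheetEvans (lam : ℂ) : ℂ := (lam ^ 2 - (Uinf : ℂ) ^ 2) / (lam ^ 2 + (Uinf : ℂ) ^ 2)

/-- The working disc `|λ - U₊| ≤ U₊/4` around the sheet root. [folklore] -/
def disc : Set ℂ := closedBall (Uinf : ℂ) (Uinf / 4)

/-- The Volterra kernel of the Jost equation `m = g + ∫_y^∞ k_α(t-y) V m`:
`k_α(u) = (1 - e^{-2αu})/(2α)` (`= u` at `α = 0`); `0 ≤ k_α(u) ≤ u` for `u ≥ 0`. [folklore] -/
def volterraKernel (α u : ℝ) : ℝ := if α = 0 then u else (1 - Real.exp (-(2 * α * u))) / (2 * α)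

/-! ## §2 The stub statements (predicates; the registered stubs quantify their parameters) -/

/-- **Weighted Volterra theory on `ℝ`, weight `(1+|y|)^k`, potential size `A` (uniform in `α ∈ [0,1]`).**
There is `C` such that for `α ∈ [0,1]`, continuous `V` with `‖V t‖ ≤ A e^{-t²/4}` and continuous `g`
with `‖g y‖ ≤ (1+|y|)^k`, the equation `m(y) = g(y) + ∫_{t>y} k_α(t-y) V(t) m(t) dt` has a continuous
solution with `‖m y‖ ≤ C (1+|y|)^k`, unique among continuous functions of polynomial growth of order
`k` (Volterra iteration: relative to the weights the kernel is bounded by `(1+|t|)^{k+1}‖V t‖ ∈ L¹`;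
meant for `k ≥ 1`).  Registered stub: `stub_volterra : ∀ k, 1 ≤ k → ∀ A, VolterraPackage k A`.
[folklore] -/
def VolterraPackage (k : ℕ) (A : ℝ) : Prop :=
  ∃ C : ℝ, ∀ α : ℝ, 0 ≤ α → α ≤ 1 → ∀ V : ℝ → ℂ, Continuous V →
    (∀ t : ℝ, ‖V t‖ ≤ A * Real.exp (-(t ^ 2) / 4)) → ∀ g : ℝ → ℂ, Continuous g →
    (∀ y : ℝ, ‖g y‖ ≤ (1 + |y|) ^ k) →
    (∃ m : ℝ → ℂ, Continuous m ∧ (∀ y : ℝ, ‖m y‖ ≤ C * (1 + |y|) ^ k) ∧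
        ∀ y : ℝ, m y = g y + ∫ t in Ioi y, (volterraKernel α (t - y) : ℂ) * V t * m t) ∧
    (∀ m₁ m₂ : ℝ → ℂ, Continuous m₁ → Continuous m₂ →
        (∃ B : ℝ, ∀ y : ℝ, ‖m₁ y‖ ≤ B * (1 + |y|) ^ k) →
        (∃ B : ℝ, ∀ y : ℝ, ‖m₂ y‖ ≤ B * (1 + |y|) ^ k) →
        (∀ y : ℝ, m₁ y = g y + ∫ t in Ioi y, (volterraKernel α (t - y) : ℂ) * V t * m₁ t) →
        (∀ y : ℝ, m₂ y = g y + ∫ t in Ioi y, (volterraKernel α (t - y) : ℂ) * V t * m₂ t) →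
        m₁ = m₂)

/-- **Rayleigh Jost solutions of the erf layer (`h = 0` slow modes) on `re λ ≥ ℓ`, with an
`α`-uniform growth constant**: there is `C₀` such that for `α ∈ (0,1]` and `re λ ≥ ℓ` a slow mode
`ψ = e^{-αy} m` at `h = 0` exists with `‖e^{αy}ψ(y)‖ ≤ C₀(1+|y|)`.  Registered stub:
`stub_rayleighJost : (∀ k, 1 ≤ k → ∀ A, VolterraPackage k A) → ∀ ℓ, 0 < ℓ → RayleighJostPackage ℓ`.
[folklore] -/
def RayleighJostPackage (ℓ : ℝ) : Prop :=
  ∃ C₀ : ℝ, ∀ α : ℝ, 0 < α → α ≤ 1 → ∀ lam : ℂ, ℓ ≤ lam.re →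
    ∃ ψ : ℝ → ℂ, IsSlowMode α 0 lam ψ ∧ ∀ y : ℝ, ‖(Real.exp (α * y) : ℂ) * ψ y‖ ≤ C₀ * (1 + |y|)

/-- **Vortex-sheet (long-wave) limit of the Rayleigh sheet coefficient, growth constant `C₀`,
accuracy `ε`**: there is `α₁ ∈ (0,1]` such that every `h = 0` slow mode with `α ≤ α₁`, `λ` in the disc
and `‖e^{αy}ψ‖ ≤ C₀(1+|y|)` has `‖sheetCoeff α ψ - sheetEvans λ‖ ≤ ε` (first-order expansion of
`m = e^{αy}ψ` in `α`: `m = m₀ + α m₁ + O(α²)`, `m₀ = (U-iλ)/(U₊-iλ)`, `∫ V m₀ = 0`,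
`1 + ½∫ V m₁ = sheetEvans λ`).  Registered stub:
`stub_sheetLimit : (∀ k, 1 ≤ k → ∀ A, VolterraPackage k A) → ∀ C₀, 0 < C₀ → ∀ ε, 0 < ε → SheetLimitPackage C₀ ε`.
[folklore] -/
def SheetLimitPackage (C₀ ε : ℝ) : Prop :=
  ∃ α₁ : ℝ, 0 < α₁ ∧ α₁ ≤ 1 ∧ ∀ α : ℝ, 0 < α → α ≤ α₁ →
    ∀ lam ∈ disc, ∀ ψ : ℝ → ℂ, IsSlowMode α 0 lam ψ →
      (∀ y : ℝ, ‖(Real.exp (α * y) : ℂ) * ψ y‖ ≤ C₀ * (1 + |y|)) →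
      ‖sheetCoeff α ψ - sheetEvans lam‖ ≤ ε

/-- **Gaussian-class resolvent of `λ + iU - h·OU` with the `h`-UNIFORM bound constant `K`**: for
`α ∈ (0,1]`, `re λ > 0`, `0 < h ≤ re λ` and continuous `F` with `‖F‖ ≤ C e^{-y²/4}` the resolvent
equation has a Gaussian-class `C²` solution with `‖ω y‖ ≤ (K C / re λ) e^{-y²/4}` (Green's function of
the two recessive solutions of the Weber-type equation `W'' = ((λ+iU)/h + y²/4 + α² - ½) W`,
`W = e^{y²/4} ω`, exponential dichotomy with `re ≥ re λ/h - ½`).  Registered stub: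
`stub_resolventExists : ∃ K, ResolventBound K`. [folklore] -/
def ResolventBound (K : ℝ) : Prop :=
  ∀ α : ℝ, 0 < α → α ≤ 1 → ∀ lam : ℂ, 0 < lam.re → ∀ h : ℝ, 0 < h → h ≤ lam.re →
    ∀ F : ℝ → ℂ, Continuous F → ∀ C : ℝ, GaussBound F C →
      ∃ ω : ℝ → ℂ, IsResolventSol α h lam F ω ∧ GaussBound ω (K * C / lam.re)

/-- **Uniqueness in the Gaussian class at `(α, h, λ)`** (Weber energy lemma: a bounded `C²` solution of
`W'' = (y²/4 + μ + iν(y)) W`, `μ > -½`, vanishes; here `μ = re λ/h + α² - ½`).  Registered stub: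
`stub_resolventUnique : ∀ α, 0 < α → α ≤ 1 → ∀ lam : ℂ, 0 < lam.re → ∀ h, 0 < h → ResolventUniqueAt α h lam`.
[folklore] -/
def ResolventUniqueAt (α h : ℝ) (lam : ℂ) : Prop :=
  ∀ ω : ℝ → ℂ, IsResolventSol α h lam (fun _ => 0) ω → ∀ y : ℝ, ω y = 0

/-- **Strained slow modes at wavenumber `α`, accuracy `ε`: existence, continuity in `λ`, and
`ε`-closeness of the sheet coefficient** (dissipative persistence): there is `h₀ > 0` such that for
`0 < h ≤ h₀` there is a family `Ψ λ` of slow modes on the disc whose sheet coefficient is continuous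
in `λ` and within `ε` of that of ANY `h = 0` slow mode at the same `(α, λ)`.  Registered stub:
`stub_strained : (∀ k, 1 ≤ k → ∀ A, VolterraPackage k A) → (∃ K, ResolventBound K) →
(∀ α, 0 < α → α ≤ 1 → ∀ lam : ℂ, 0 < lam.re → ∀ h, 0 < h → ResolventUniqueAt α h lam) →
∀ α, 0 < α → α ≤ 1 → ∀ ε, 0 < ε → StrainedPackage α ε`. [folklore] -/
def StrainedPackage (α ε : ℝ) : Prop :=
  ∃ h₀ : ℝ, 0 < h₀ ∧ ∀ h : ℝ, 0 < h → h ≤ h₀ →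
    ∃ Ψ : ℂ → ℝ → ℂ, (∀ lam ∈ disc, IsSlowMode α h lam (Ψ lam)) ∧
      ContinuousOn (fun lam : ℂ => sheetCoeff α (Ψ lam)) disc ∧
      ∀ lam ∈ disc, ∀ ψ₀ : ℝ → ℂ, IsSlowMode α 0 lam ψ₀ →
        ‖sheetCoeff α (Ψ lam) - sheetCoeff α ψ₀‖ ≤ ε

/-- **A slow mode with vanishing sheet coefficient is an eigenmode of the crux** at Reynolds number
`Re`, `h = 1/(α Re)`, `σ = λ·α·Re` (the body of `BurgersLayerKH` except `0 < α` and the growth-rate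
clause): `ψ = (2α)⁻¹[e^{αy}∫_y^∞ e^{-αt}ω + e^{-αy}∫_{-∞}^y e^{αt}ω]` decays at both ends.
Registered stub: `stub_modeOfZero : ∀ α Re : ℝ, ModeOfZero α Re`. [folklore] -/
def ModeOfZero (α Re : ℝ) : Prop :=
  0 < α → 0 < Re → ∀ lam : ℂ, ∀ ψ : ℝ → ℂ,
    IsSlowMode α (1 / (α * Re)) lam ψ → sheetCoeff α ψ = 0 →
    let σ : ℂ := lam * ((α * Re : ℝ) : ℂ)
    let U : ℝ → ℝ := fun y => ∫ s in (0:ℝ)..y, Real.exp (-(s ^ 2) / 2)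
    let U'' : ℝ → ℝ := fun y => -(y * Real.exp (-(y ^ 2) / 2))
    let ω : ℝ → ℂ := fun y => -(iteratedDeriv 2 ψ y - (α : ℂ) ^ 2 * ψ y)
    ContDiff ℝ 4 ψ ∧ (∃ y, ψ y ≠ 0) ∧ Tendsto ψ atTop (𝓝 0) ∧ Tendsto ψ atBot (𝓝 0) ∧
      (∃ C : ℝ, ∀ y : ℝ, ‖ω y‖ ≤ C * Real.exp (-(y ^ 2) / 4)) ∧
      ∀ y : ℝ, σ * ω y = -(Complex.I * α * Re) * ((U y : ℂ) * ω y + (U'' y : ℂ) * ψ y) + ω y +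
        (y : ℂ) * deriv ω y + iteratedDeriv 2 ω y - (α : ℂ) ^ 2 * ω y

/-! ## §3 Sorry-free glue: the sheet dispersion function near its root -/

/-- `U₊ = √(π/2) > 0`. [folklore] -/
theorem Uinf_pos : 0 < Uinf := Real.sqrt_pos.2 (by positivity)

/-- On the disc, `‖λ² + U₊²‖ ≥ 23 U₊²/16`. [folklore] -/
theorem norm_sq_add_sq_ge {lam : ℂ} (hlam : lam ∈ disc) :
    23 * Uinf ^ 2 / 16 ≤ ‖lam ^ 2 + (Uinf : ℂ) ^ 2‖ := by
  have hU := Uinf_pos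
  set z : ℂ := lam - Uinf with hz
  have hzle : ‖z‖ ≤ Uinf / 4 := by
    have := hlam
    rw [disc, mem_closedBall, dist_eq_norm] at this
    simpa [hz] using this
  have hlamz : lam = Uinf + z := by rw [hz]; ring
  have hdecomp : lam ^ 2 + (Uinf : ℂ) ^ 2 = 2 * (Uinf : ℂ) ^ 2 + (2 * (Uinf : ℂ) * z + z ^ 2) := by
    rw [hlamz]; ring
  have hsmall : ‖2 * (Uinf : ℂ) * z + z ^ 2‖ ≤ 9 * Uinf ^ 2 / 16 := by
    have h1 : ‖2 * (Uinf : ℂ) * z‖ ≤ 2 * Uinf * (Uinf / 4) := by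
      rw [norm_mul, norm_mul, Complex.norm_real, Real.norm_of_nonneg hU.le]
      simp only [Complex.norm_ofNat]
      gcongr
    have h2 : ‖z ^ 2‖ ≤ (Uinf / 4) ^ 2 := by
      rw [norm_pow]; gcongr
    calc ‖2 * (Uinf : ℂ) * z + z ^ 2‖ ≤ ‖2 * (Uinf : ℂ) * z‖ + ‖z ^ 2‖ := norm_add_le _ _
      _ ≤ 2 * Uinf * (Uinf / 4) + (Uinf / 4) ^ 2 := add_le_add h1 h2
      _ = 9 * Uinf ^ 2 / 16 := by ring
  have hbig : ‖(2 * (Uinf : ℂ) ^ 2 : ℂ)‖ = 2 * Uinf ^ 2 := by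
    rw [norm_mul, norm_pow, Complex.norm_real, Real.norm_of_nonneg hU.le]
    simp
  have := norm_sub_norm_le (2 * (Uinf : ℂ) ^ 2) (-(2 * (Uinf : ℂ) * z + z ^ 2))
  rw [sub_neg_eq_add, norm_neg, hbig] at this
  rw [hdecomp]
  linarith

/-- The Newton-type map `λ ↦ λ - U₊·a` sends the disc into itself as soon as `‖a - sheetEvans λ‖ ≤ 1/8`.
[folklore] -/
theorem newton_mapsTo {lam a : ℂ} (hlam : lam ∈ disc) (ha : ‖a - sheetEvans lam‖ ≤ 1 / 8) :
    lam - (Uinf : ℂ) * a ∈ disc := by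
  have hU := Uinf_pos
  set z : ℂ := lam - Uinf with hz
  have hzle : ‖z‖ ≤ Uinf / 4 := by
    have := hlam
    rw [disc, mem_closedBall, dist_eq_norm] at this
    simpa [hz] using this
  have hlamz : lam = Uinf + z := by rw [hz]; ring
  have hD := norm_sq_add_sq_ge hlam
  have hDpos : 0 < ‖lam ^ 2 + (Uinf : ℂ) ^ 2‖ := by nlinarith
  have hDne : lam ^ 2 + (Uinf : ℂ) ^ 2 ≠ 0 := norm_pos_iff.1 hDpos
  -- algebra: `λ - U₊ - U₊·sheetEvans λ = λ (λ - U₊)² / (λ² + U₊²)`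
  have halg : lam - (Uinf : ℂ) - (Uinf : ℂ) * sheetEvans lam =
      lam * (lam - Uinf) ^ 2 / (lam ^ 2 + (Uinf : ℂ) ^ 2) := by
    unfold sheetEvans
    field_simp
    ring
  have hmain : ‖lam * (lam - Uinf) ^ 2 / (lam ^ 2 + (Uinf : ℂ) ^ 2)‖ ≤ Uinf / 16 := by
    rw [norm_div, norm_mul, norm_pow, ← hz]
    have hlamn : ‖lam‖ ≤ 5 * Uinf / 4 := by
      rw [hlamz]
      calc ‖(Uinf : ℂ) + z‖ ≤ ‖(Uinf : ℂ)‖ + ‖z‖ := norm_add_le _ _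
        _ ≤ Uinf + Uinf / 4 := by
            rw [Complex.norm_real, Real.norm_of_nonneg hU.le]; gcongr
        _ = 5 * Uinf / 4 := by ring
    rw [div_le_iff₀ hDpos]
    have hz2 : ‖z‖ ^ 2 ≤ (Uinf / 4) ^ 2 := by gcongr
    calc ‖lam‖ * ‖z‖ ^ 2 ≤ (5 * Uinf / 4) * (Uinf / 4) ^ 2 := by gcongr
      _ = (5 / 92) * Uinf * (23 * Uinf ^ 2 / 16) := by ring
      _ ≤ Uinf / 16 * (23 * Uinf ^ 2 / 16) := by
          apply mul_le_mul_of_nonneg_right _ (by positivity); linarith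
      _ ≤ Uinf / 16 * ‖lam ^ 2 + (Uinf : ℂ) ^ 2‖ := by gcongr
  rw [disc, mem_closedBall, dist_eq_norm]
  have hsplit : lam - (Uinf : ℂ) * a - Uinf =
      lam * (lam - Uinf) ^ 2 / (lam ^ 2 + (Uinf : ℂ) ^ 2) - (Uinf : ℂ) * (a - sheetEvans lam) := by
    rw [← halg]; ring
  rw [hsplit]
  calc ‖lam * (lam - Uinf) ^ 2 / (lam ^ 2 + (Uinf : ℂ) ^ 2) - (Uinf : ℂ) * (a - sheetEvans lam)‖
      ≤ ‖lam * (lam - Uinf) ^ 2 / (lam ^ 2 + (Uinf : ℂ) ^ 2)‖ + ‖(Uinf : ℂ) * (a - sheetEvans lam)‖ :=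
        norm_sub_le _ _
    _ ≤ Uinf / 16 + Uinf * (1 / 8) := by
        refine add_le_add hmain ?_
        rw [norm_mul, Complex.norm_real, Real.norm_of_nonneg hU.le]
        gcongr
    _ ≤ Uinf / 4 := by linarith

/-- Points of the disc have `re λ ≥ 3U₊/4`. [folklore] -/
theorem re_ge_of_mem_disc {lam : ℂ} (hlam : lam ∈ disc) : 3 * Uinf / 4 ≤ lam.re := by
  rw [disc, mem_closedBall, dist_eq_norm] at hlam
  have h := Complex.abs_re_le_norm (lam - Uinf)
  rw [Complex.sub_re, Complex.ofReal_re] at h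
  have := (abs_le.1 (h.trans hlam)).1
  linarith

/-! ## §4 The composition: the seven stubs imply the crux BY NAME -/

/-- **Composition.** The seven registered stubs imply `BurgersLayerKH` (Brouwer on the disc for the
Newton map of the strained sheet coefficient, then `ModeOfZero`). [folklore] -/
theorem BurgersLayerKH_of (hV : ∀ k : ℕ, 1 ≤ k → ∀ A : ℝ, VolterraPackage k A)
    (hJ : (∀ k : ℕ, 1 ≤ k → ∀ A : ℝ, VolterraPackage k A) → ∀ ℓ : ℝ, 0 < ℓ → RayleighJostPackage ℓ)
    (hL : (∀ k : ℕ, 1 ≤ k → ∀ A : ℝ, VolterraPackage k A) →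
      ∀ C₀ : ℝ, 0 < C₀ → ∀ ε : ℝ, 0 < ε → SheetLimitPackage C₀ ε)
    (hE : ∃ K : ℝ, ResolventBound K)
    (hUq : ∀ α : ℝ, 0 < α → α ≤ 1 → ∀ lam : ℂ, 0 < lam.re → ∀ h : ℝ, 0 < h → ResolventUniqueAt α h lam)
    (hS : (∀ k : ℕ, 1 ≤ k → ∀ A : ℝ, VolterraPackage k A) → (∃ K : ℝ, ResolventBound K) →
      (∀ α : ℝ, 0 < α → α ≤ 1 → ∀ lam : ℂ, 0 < lam.re → ∀ h : ℝ, 0 < h → ResolventUniqueAt α h lam) →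
      ∀ α : ℝ, 0 < α → α ≤ 1 → ∀ ε : ℝ, 0 < ε → StrainedPackage α ε)
    (hZ : ∀ α Re : ℝ, ModeOfZero α Re) : BurgersLayerKH := by
  have hUpos := Uinf_pos
  -- (1) Rayleigh Jost modes with a uniform growth constant on `re λ ≥ U₊/2`
  obtain ⟨C₀, hC₀⟩ := hJ hV (Uinf / 2) (by positivity)
  set C₁ : ℝ := max C₀ 1 with hC₁
  have hC₁pos : 0 < C₁ := lt_of_lt_of_le zero_lt_one (le_max_right _ _)
  -- (2) the sheet limit: fix `α`
  obtain ⟨α, hα, hα1, hsheet⟩ := hL hV C₁ hC₁pos (1 / 16) (by norm_num)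
  -- (3) strained slow modes for `h ≤ h₀`
  obtain ⟨h₀, hh₀, hstr⟩ := hS hV hE hUq α hα hα1 (1 / 16) (by norm_num)
  -- the witnesses `Re₂ = 1/(α h₀)`, `c₀ = (3U₊/4)·α`
  refine ⟨1 / (α * h₀), 3 * Uinf / 4 * α, by positivity, fun Re hRe => ?_⟩
  have hRepos : 0 < Re := lt_of_lt_of_le (by positivity) hRe
  set h : ℝ := 1 / (α * Re) with hh_def
  have hhpos : 0 < h := by positivity
  have hhle : h ≤ h₀ := by
    rw [hh_def, div_le_iff₀ (by positivity)]
    rw [div_le_iff₀ (by positivity)] at hRe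
    nlinarith
  obtain ⟨Ψ, hΨ, hcont, hclose⟩ := hstr h hhpos hhle
  -- (4) the strained sheet coefficient is within 1/8 of `sheetEvans` on the disc
  have key : ∀ lam ∈ disc, ‖sheetCoeff α (Ψ lam) - sheetEvans lam‖ ≤ 1 / 8 := by
    intro lam hlam
    have hre : Uinf / 2 ≤ lam.re := by linarith [re_ge_of_mem_disc hlam]
    obtain ⟨ψ₀, hψ₀, hgrow⟩ := hC₀ α hα hα1 lam hre
    have hgrow' : ∀ y : ℝ, ‖(Real.exp (α * y) : ℂ) * ψ₀ y‖ ≤ C₁ * (1 + |y|) := fun y =>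
      (hgrow y).trans (mul_le_mul_of_nonneg_right (le_max_left _ _) (by positivity))
    have h1 := hclose lam hlam ψ₀ hψ₀
    have h2 := hsheet α hα le_rfl lam hlam ψ₀ hψ₀ hgrow'
    calc ‖sheetCoeff α (Ψ lam) - sheetEvans lam‖
        ≤ ‖sheetCoeff α (Ψ lam) - sheetCoeff α ψ₀‖ + ‖sheetCoeff α ψ₀ - sheetEvans lam‖ :=
          norm_sub_le_norm_sub_add_norm_sub _ _ _
      _ ≤ 1 / 16 + 1 / 16 := add_le_add h1 h2
      _ = 1 / 8 := by norm_num
  -- (5) Brouwer for the Newton map `G λ = λ - U₊ · a(λ)` on the disc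
  set G : ℂ → ℂ := fun lam => lam - (Uinf : ℂ) * sheetCoeff α (Ψ lam) with hG
  have hGcont : ContinuousOn G disc :=
    continuousOn_id.sub (continuousOn_const.mul hcont)
  have hGmaps : MapsTo G disc disc := fun lam hlam => newton_mapsTo hlam (key lam hlam)
  obtain ⟨lam, hlam, hfix⟩ :=
    Literature.Topology.Euclidean.Brouwer.exists_fixedPoint_closedBall_of_finiteDimensional
      (by positivity : (0 : ℝ) ≤ Uinf / 4) hGcont hGmaps
  have hzero : sheetCoeff α (Ψ lam) = 0 := by
    have h1 : (Uinf : ℂ) * sheetCoeff α (Ψ lam) = 0 := by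
      have := hfix
      simp only [hG] at this
      linear_combination -this
    rcases mul_eq_zero.1 h1 with h2 | h2
    · exact absurd (by exact_mod_cast h2 : Uinf = 0) hUpos.ne'
    · exact h2
  -- (6) the zero is an eigenmode
  have hmode : IsSlowMode α (1 / (α * Re)) lam (Ψ lam) := hΨ lam hlam
  have hbody := hZ α Re hα hRepos lam (Ψ lam) hmode hzero
  refine ⟨α, lam * ((α * Re : ℝ) : ℂ), Ψ lam, ?_⟩
  obtain ⟨hC4, hne, htop, hbot, hgauss, heq⟩ := hbody
  refine ⟨hα, ?_, hC4, hne, htop, hbot, hgauss, heq⟩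
  -- growth rate: `re σ = re λ · α · Re ≥ (3U₊/4) α Re`
  have hre := re_ge_of_mem_disc hlam
  rw [Complex.mul_re, Complex.ofReal_re, Complex.ofReal_im, mul_zero, sub_zero]
  nlinarith [mul_pos hα hRepos]

/-- **Registered sub-goal `line_glue`**: the seven registered stub signatures imply the crux (this is
`BurgersLayerKH_of`, curried over the stub statements verbatim). [folklore] -/
theorem line_glue : (∀ k : ℕ, 1 ≤ k → ∀ A : ℝ, VolterraPackage k A) → ((∀ k : ℕ, 1 ≤ k → ∀ A : ℝ, VolterraPackage k A) → ∀ ℓ : ℝ, 0 < ℓ → RayleighJostPackage ℓ) → ((∀ k : ℕ, 1 ≤ k → ∀ A : ℝ, VolterraPackage k A) → ∀ C₀ : ℝ, 0 < C₀ → ∀ ε : ℝ, 0 < ε → SheetLimitPackage C₀ ε) → (∃ K : ℝ, ResolventBound K) → (∀ α : ℝ, 0 < α → α ≤ 1 → ∀ lam : ℂ, 0 < lam.re → ∀ h : ℝ, 0 < h → ResolventUniqueAt α h lam) → ((∀ k : ℕ, 1 ≤ k → ∀ A : ℝ, VolterraPackage k A) → (∃ K : ℝ, ResolventBound K) → (∀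 α : ℝ, 0 < α → α ≤ 1 → ∀ lam : ℂ, 0 < lam.re → ∀ h : ℝ, 0 < h → ResolventUniqueAt α h lam) → ∀ α : ℝ, 0 < α → α ≤ 1 → ∀ ε : ℝ, 0 < ε → StrainedPackage α ε) → (∀ α Re : ℝ, ModeOfZero α Re) → BurgersLayerKH :=
  BurgersLayerKH_of

end Summit.AnomalousDissipation.AnomalousDissipation.Theorems.BurgersLayerKH.Sheet

end
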